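import Summits.HodgeConjecture.CorCM.IrreducibleOddWeightsWielandt
import Summits.HodgeConjecture.CorCM.IrreducibleOddWeightsCMFields
import HarnessLib

/-!
# CM fields with exactly one non-self-conjugate stabiliser orbit pair: irreducible odd weights ⟺ the orbital operator
# has no rational eigenvector — a decidable test for (IRR)

COR-CM (cell `pub-hodgecm2`, binder seat `b16` gen 55, count-neutral claim IRR-ODD, file F7b — the CM-field dress of F7
`CorCM/IrreducibleOddWeightsWielandt`; theorems only, no definition, no named fact, no `sorry`).  NEW as stated, hence
under `Summits/`.  HONEST FRAMING: statements about the `Aut(ℂ)`-module of odd weights of ONE CM field; `HC_CM` is neither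
used nor asserted.

Setting: `K` a CM field, `x₀, y₁ : K → ℂ` embeddings with `y₁ ∉ {x₀, x̄₀}` such that (SC) FAILS at `(x₀, y₁)` (no
automorphism of `ℂ` fixes `x₀` and conjugates `y₁`; field test `x₀(K) ⊆ y₁(K)·x₀(K⁺)`, gen 54) while every other
embedding `x ∉ {x₀, x̄₀}` either passes (SC) at `x₀` or is conjugate over `x₀(K)` to `y₁` or to `ȳ₁` — ONE non-self-
conjugate orbit pair, `p = 1`, commutant dimension `d = 2` (F3/F7).  `T₁` = the orbital operator of `(x₀, y₁)` (exists by
F3 `IrrOdd.exists_orbitalOperator`; characterised by `T₁ δ_{x₀} = 𝟙_{O} − 𝟙_{Ō}`, `O = Aut(ℂ/x₀K)·y₁`).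

* **`exists_coeffs_of_odd_equivariant_one`** — every `Aut(ℂ)`-equivariant odd-valued endomorphism of `ℚ^{Hom(K,ℂ)}` is
  `c₀·(f ↦ f − f∘ρ) + c₁·T₁` (Wielandt).
* **`antiWeights_irreducible_iff_forall_eigen`** — (IRR) for `K` ⟺ `T₁` has no eigenvector among the odd weights with a
  rational eigenvalue; **`isNondegenerate_of_forall_eigen`**, **`isSimple_of_forall_eigen`** — then every CM type of
  `K` is nondegenerate and every abelian variety with CM by `K` is simple (F2), and the whole (IRR) package (F2/F4/F6b)
  applies; on a Galois model the test is the irreducibility over `ℚ` of the quadratic minimal polynomial of `T₁|_{Anti}`.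

## References

* [Wielandt1964] H. Wielandt, *Finite Permutation Groups* (1964), Thm. 28.4, §29.
* [Serre1977] J.-P. Serre, *Linear Representations of Finite Groups*, GTM 42 (1977), §1.3 Thm. 1, §2.2 Prop. 4.
* [Shimura1998] G. Shimura, *Abelian Varieties with Complex Multiplication and Modular Functions*, §8.2 Prop. 26.
-/

set_option autoImplicit false

noncomputable section

open CategoryTheory CategoryTheory.Limits NumberField

namespace Summit.HodgeConjecture.CorCM

open Literature.NumberTheory.ComplexMultiplication
open Literature.AlgebraicGeometry.Motives (AbelianVariety CMType)
open Literature.AlgebraicGeometry.HodgeTheory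
open Literature.AlgebraicGeometry.ComplexMultiplication (IsCMTypeRealisation)
open Literature.AlgebraicGeometry.Pohlmann1968
open GenericCMField
open scoped Classical

variable {K : Type} [Field K] [NumberField K] [IsCMField K]

/-- **Wielandt's expansion for a CM field with one non-self-conjugate orbit pair**: every `Aut(ℂ)`-equivariant
odd-valued endomorphism `S` of `ℚ^{Hom(K,ℂ)}` is `c₀·(f ↦ f − f∘ρ) + c₁·T₁`. [cite: Wielandt1964, Thm. 28.4] -/
theorem exists_coeffs_of_odd_equivariant_one {x₀ y₁ : K →+* ℂ} (hy₀ : y₁ ≠ x₀)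
    (hy₀' : y₁ ≠ (starRingAut : ℂ ≃+* ℂ) • x₀)
    (hncs : ∀ σ : ℂ ≃+* ℂ, σ • x₀ = x₀ → σ • y₁ ≠ (starRingAut : ℂ ≃+* ℂ) • y₁)
    (hcover : ∀ x : K →+* ℂ, x ≠ x₀ → x ≠ (starRingAut : ℂ ≃+* ℂ) • x₀ →
      (∃ σ : ℂ ≃+* ℂ, σ • x₀ = x₀ ∧ σ • x = (starRingAut : ℂ ≃+* ℂ) • x) ∨
        ∃ σ : ℂ ≃+* ℂ, σ • x₀ = x₀ ∧ (σ • y₁ = x ∨ σ • y₁ = (starRingAut : ℂ ≃+* ℂ) • x))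
    (T₁ : ((K →+* ℂ) → ℚ) →ₗ[ℚ] ((K →+* ℂ) → ℚ))
    (hT : ∀ (g : ℂ ≃+* ℂ) (f : (K →+* ℂ) → ℚ), T₁ (fun x => f (g⁻¹ • x)) = fun x => T₁ f (g⁻¹ • x))
    (hTodd : ∀ (f : (K →+* ℂ) → ℚ) (x : K →+* ℂ), T₁ f ((starRingAut : ℂ ≃+* ℂ) • x) = -T₁ f x)
    (hTδ : ∀ z : K →+* ℂ, T₁ (fun y' => if y' = x₀ then (1 : ℚ) else 0) z =
      (if ∃ g : ℂ ≃+* ℂ, g • x₀ = x₀ ∧ g • y₁ = z then (1 : ℚ) else 0) -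
        if ∃ g : ℂ ≃+* ℂ, g • x₀ = x₀ ∧ g • y₁ = (starRingAut : ℂ ≃+* ℂ) • z then (1 : ℚ) else 0)
    (S : ((K →+* ℂ) → ℚ) →ₗ[ℚ] ((K →+* ℂ) → ℚ))
    (hS : ∀ (g : ℂ ≃+* ℂ) (f : (K →+* ℂ) → ℚ), S (fun x => f (g⁻¹ • x)) = fun x => S f (g⁻¹ • x))
    (hSodd : ∀ (f : (K →+* ℂ) → ℚ) (x : K →+* ℂ), S f ((starRingAut : ℂ ≃+* ℂ) • x) = -S f x) :
    ∃ c₀ c₁ : ℚ, ∀ f, S f = c₀ • (fun x => f x - f ((starRingAut : ℂ ≃+* ℂ) • x)) + c₁ • T₁ f := by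
  haveI := isPretransitive_ringEquiv_complex (K := K)
  obtain ⟨c₀, c, h⟩ := IrrOdd.exists_coeffs_of_odd_equivariant (G := ℂ ≃+* ℂ) smul_conj_smul conj_smul_conj_smul
    conj_smul_ne (fun _ : Fin 1 => y₁) (fun _ => hy₀) (fun _ => hy₀') (fun _ => hncs)
    (fun j k hjk => absurd (Subsingleton.elim j k) hjk)
    (fun x hx hx' => (hcover x hx hx').imp_right fun ⟨g, hg, hgx⟩ => ⟨0, g, hg, hgx⟩)
    (fun _ => T₁) (fun _ => hT) (fun _ => hTodd) (fun _ => hTδ) S hS hSodd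
  exact ⟨c₀, c 0, fun f => by rw [h f, Fin.sum_univ_one]⟩

/-- **ONE NON-SELF-CONJUGATE ORBIT PAIR: (IRR) FOR `K` ⟺ THE ORBITAL OPERATOR `T₁` HAS NO EIGENVECTOR AMONG THE ODD
WEIGHTS WITH A RATIONAL EIGENVALUE.** [cite: Wielandt1964, Thm. 28.4] [cite: Serre1977, §1.3 Thm. 1 and §2.2 Prop. 4] -/
theorem antiWeights_irreducible_iff_forall_eigen {x₀ y₁ : K →+* ℂ} (hy₀ : y₁ ≠ x₀)
    (hy₀' : y₁ ≠ (starRingAut : ℂ ≃+* ℂ) • x₀)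
    (hncs : ∀ σ : ℂ ≃+* ℂ, σ • x₀ = x₀ → σ • y₁ ≠ (starRingAut : ℂ ≃+* ℂ) • y₁)
    (hcover : ∀ x : K →+* ℂ, x ≠ x₀ → x ≠ (starRingAut : ℂ ≃+* ℂ) • x₀ →
      (∃ σ : ℂ ≃+* ℂ, σ • x₀ = x₀ ∧ σ • x = (starRingAut : ℂ ≃+* ℂ) • x) ∨
        ∃ σ : ℂ ≃+* ℂ, σ • x₀ = x₀ ∧ (σ • y₁ = x ∨ σ • y₁ = (starRingAut : ℂ ≃+* ℂ) • x))
    (T₁ : ((K →+* ℂ) → ℚ) →ₗ[ℚ] ((K →+* ℂ) → ℚ))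
    (hT : ∀ (g : ℂ ≃+* ℂ) (f : (K →+* ℂ) → ℚ), T₁ (fun x => f (g⁻¹ • x)) = fun x => T₁ f (g⁻¹ • x))
    (hTodd : ∀ (f : (K →+* ℂ) → ℚ) (x : K →+* ℂ), T₁ f ((starRingAut : ℂ ≃+* ℂ) • x) = -T₁ f x)
    (hTδ : ∀ z : K →+* ℂ, T₁ (fun y' => if y' = x₀ then (1 : ℚ) else 0) z =
      (if ∃ g : ℂ ≃+* ℂ, g • x₀ = x₀ ∧ g • y₁ = z then (1 : ℚ) else 0) -
        if ∃ g : ℂ ≃+* ℂ, g • x₀ = x₀ ∧ g • y₁ = (starRingAut : ℂ ≃+* ℂ) • z then (1 : ℚ) else 0) :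
    (∀ W : Submodule ℚ ((K →+* ℂ) → ℚ), W ≤ antiWeights (E := K →+* ℂ) (starRingAut : ℂ ≃+* ℂ) → W ≠ ⊥ →
      (∀ (k : ℂ ≃+* ℂ) (f : (K →+* ℂ) → ℚ), f ∈ W → (fun y => f (k • y)) ∈ W) →
      W = antiWeights (E := K →+* ℂ) (starRingAut : ℂ ≃+* ℂ)) ↔
    ∀ (a : ℚ) (v : (K →+* ℂ) → ℚ), v ∈ antiWeights (E := K →+* ℂ) (starRingAut : ℂ ≃+* ℂ) → T₁ v = a • v →
      v = 0 := by
  haveI := isPretransitive_ringEquiv_complex (K := K)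
  exact IrrOdd.irreducible_iff_forall_eigen (G := ℂ ≃+* ℂ) smul_conj_smul conj_smul_conj_smul conj_smul_ne hy₀ hy₀'
    hncs hcover T₁ hT hTodd hTδ

/-- **No rational eigenvector ⟹ every CM type of `K` is nondegenerate** (via (IRR), F2).
[cite: Wielandt1964, Thm. 28.4] [cite: Shimura1998, §8.2 Prop. 26] -/
theorem isNondegenerate_of_forall_eigen {x₀ y₁ : K →+* ℂ} (hy₀ : y₁ ≠ x₀)
    (hy₀' : y₁ ≠ (starRingAut : ℂ ≃+* ℂ) • x₀)
    (hncs : ∀ σ : ℂ ≃+* ℂ, σ • x₀ = x₀ → σ • y₁ ≠ (starRingAut : ℂ ≃+* ℂ) • y₁)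
    (hcover : ∀ x : K →+* ℂ, x ≠ x₀ → x ≠ (starRingAut : ℂ ≃+* ℂ) • x₀ →
      (∃ σ : ℂ ≃+* ℂ, σ • x₀ = x₀ ∧ σ • x = (starRingAut : ℂ ≃+* ℂ) • x) ∨
        ∃ σ : ℂ ≃+* ℂ, σ • x₀ = x₀ ∧ (σ • y₁ = x ∨ σ • y₁ = (starRingAut : ℂ ≃+* ℂ) • x))
    (T₁ : ((K →+* ℂ) → ℚ) →ₗ[ℚ] ((K →+* ℂ) → ℚ))
    (hT : ∀ (g : ℂ ≃+* ℂ) (f : (K →+* ℂ) → ℚ), T₁ (fun x => f (g⁻¹ • x)) = fun x => T₁ f (g⁻¹ • x))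
    (hTodd : ∀ (f : (K →+* ℂ) → ℚ) (x : K →+* ℂ), T₁ f ((starRingAut : ℂ ≃+* ℂ) • x) = -T₁ f x)
    (hTδ : ∀ z : K →+* ℂ, T₁ (fun y' => if y' = x₀ then (1 : ℚ) else 0) z =
      (if ∃ g : ℂ ≃+* ℂ, g • x₀ = x₀ ∧ g • y₁ = z then (1 : ℚ) else 0) -
        if ∃ g : ℂ ≃+* ℂ, g • x₀ = x₀ ∧ g • y₁ = (starRingAut : ℂ ≃+* ℂ) • z then (1 : ℚ) else 0)
    (heig : ∀ (a : ℚ) (v : (K →+* ℂ) → ℚ), v ∈ antiWeights (E := K →+* ℂ) (starRingAut : ℂ ≃+* ℂ) →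
      T₁ v = a • v → v = 0)
    (Φ : CMType K) : IsNondegenerate Φ :=
  isNondegenerate_of_irreducible
    ((antiWeights_irreducible_iff_forall_eigen hy₀ hy₀' hncs hcover T₁ hT hTodd hTδ).2 heig) Φ

/-- **No rational eigenvector ⟹ every abelian variety with CM by `K` is simple.** [cite: Shimura1998, §8.2 Prop. 26] -/
theorem isSimple_of_forall_eigen {x₀ y₁ : K →+* ℂ} (hy₀ : y₁ ≠ x₀)
    (hy₀' : y₁ ≠ (starRingAut : ℂ ≃+* ℂ) • x₀)
    (hncs : ∀ σ : ℂ ≃+* ℂ, σ • x₀ = x₀ → σ • y₁ ≠ (starRingAut : ℂ ≃+* ℂ) • y₁)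
    (hcover : ∀ x : K →+* ℂ, x ≠ x₀ → x ≠ (starRingAut : ℂ ≃+* ℂ) • x₀ →
      (∃ σ : ℂ ≃+* ℂ, σ • x₀ = x₀ ∧ σ • x = (starRingAut : ℂ ≃+* ℂ) • x) ∨
        ∃ σ : ℂ ≃+* ℂ, σ • x₀ = x₀ ∧ (σ • y₁ = x ∨ σ • y₁ = (starRingAut : ℂ ≃+* ℂ) • x))
    (T₁ : ((K →+* ℂ) → ℚ) →ₗ[ℚ] ((K →+* ℂ) → ℚ))
    (hT : ∀ (g : ℂ ≃+* ℂ) (f : (K →+* ℂ) → ℚ), T₁ (fun x => f (g⁻¹ • x)) = fun x => T₁ f (g⁻¹ • x))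
    (hTodd : ∀ (f : (K →+* ℂ) → ℚ) (x : K →+* ℂ), T₁ f ((starRingAut : ℂ ≃+* ℂ) • x) = -T₁ f x)
    (hTδ : ∀ z : K →+* ℂ, T₁ (fun y' => if y' = x₀ then (1 : ℚ) else 0) z =
      (if ∃ g : ℂ ≃+* ℂ, g • x₀ = x₀ ∧ g • y₁ = z then (1 : ℚ) else 0) -
        if ∃ g : ℂ ≃+* ℂ, g • x₀ = x₀ ∧ g • y₁ = (starRingAut : ℂ ≃+* ℂ) • z then (1 : ℚ) else 0)
    (heig : ∀ (a : ℚ) (v : (K →+* ℂ) → ℚ), v ∈ antiWeights (E := K →+* ℂ) (starRingAut : ℂ ≃+* ℂ) →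
      T₁ v = a • v → v = 0)
    {Φ : CMType K} {A : AbelianVariety ℂ} {ι : 𝓞 K →+* End A} {θ : K →+* Module.End ℂ (complexBetti A.X 1)}
    (hA : IsCMTypeRealisation Φ A ι θ) : A.IsSimple :=
  isSimple_of_irreducible ((antiWeights_irreducible_iff_forall_eigen hy₀ hy₀' hncs hcover T₁ hT hTodd hTδ).2 heig) hA

/-- **An odd eigenvector of the orbital operator makes the odd weights REDUCIBLE** (the eigenspace is a proper stable
subspace) — then `K` is not (SC), and e.g. the pair criteria of F2/F4 are not available.
[cite: Serre1977, §2.2 Prop. 4] -/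
theorem not_antiWeights_irreducible_of_eigen {x₀ y₁ : K →+* ℂ} (hy₀ : y₁ ≠ x₀)
    (hy₀' : y₁ ≠ (starRingAut : ℂ ≃+* ℂ) • x₀)
    (hncs : ∀ σ : ℂ ≃+* ℂ, σ • x₀ = x₀ → σ • y₁ ≠ (starRingAut : ℂ ≃+* ℂ) • y₁)
    (hcover : ∀ x : K →+* ℂ, x ≠ x₀ → x ≠ (starRingAut : ℂ ≃+* ℂ) • x₀ →
      (∃ σ : ℂ ≃+* ℂ, σ • x₀ = x₀ ∧ σ • x = (starRingAut : ℂ ≃+* ℂ) • x) ∨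
        ∃ σ : ℂ ≃+* ℂ, σ • x₀ = x₀ ∧ (σ • y₁ = x ∨ σ • y₁ = (starRingAut : ℂ ≃+* ℂ) • x))
    (T₁ : ((K →+* ℂ) → ℚ) →ₗ[ℚ] ((K →+* ℂ) → ℚ))
    (hT : ∀ (g : ℂ ≃+* ℂ) (f : (K →+* ℂ) → ℚ), T₁ (fun x => f (g⁻¹ • x)) = fun x => T₁ f (g⁻¹ • x))
    (hTodd : ∀ (f : (K →+* ℂ) → ℚ) (x : K →+* ℂ), T₁ f ((starRingAut : ℂ ≃+* ℂ) • x) = -T₁ f x)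
    (hTδ : ∀ z : K →+* ℂ, T₁ (fun y' => if y' = x₀ then (1 : ℚ) else 0) z =
      (if ∃ g : ℂ ≃+* ℂ, g • x₀ = x₀ ∧ g • y₁ = z then (1 : ℚ) else 0) -
        if ∃ g : ℂ ≃+* ℂ, g • x₀ = x₀ ∧ g • y₁ = (starRingAut : ℂ ≃+* ℂ) • z then (1 : ℚ) else 0)
    {a : ℚ} {v : (K →+* ℂ) → ℚ} (hv : v ∈ antiWeights (E := K →+* ℂ) (starRingAut : ℂ ≃+* ℂ)) (hv0 : v ≠ 0)
    (hTv : T₁ v = a • v) :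
    ¬ ∀ W : Submodule ℚ ((K →+* ℂ) → ℚ), W ≤ antiWeights (E := K →+* ℂ) (starRingAut : ℂ ≃+* ℂ) → W ≠ ⊥ →
      (∀ (k : ℂ ≃+* ℂ) (f : (K →+* ℂ) → ℚ), f ∈ W → (fun y => f (k • y)) ∈ W) →
      W = antiWeights (E := K →+* ℂ) (starRingAut : ℂ ≃+* ℂ) := fun hirr =>
  hv0 ((antiWeights_irreducible_iff_forall_eigen hy₀ hy₀' hncs hcover T₁ hT hTodd hTδ).1 hirr a v hv hTv)

end Summit.HodgeConjecture.CorCM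

end
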